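import Literature.NumberTheory.DiophantineGeometry.GenEllDePersistentPolys
import HarnessLib

/-!
# [GenEll] Thm. 2.1 for `ℙ¹`, the `D_e` route: persistent polynomials in the `t_c`-VALUE form

S. Mochizuki, *Arithmetic elliptic curves in general position*, Math. J. Okayama Univ. 52 (2010)
[cite: MochizukiGenEll2010, Thm 2.1 p.12].  Glue between the «bad-`c` lemma» files
(`GenEllDeCriticalCollisions`, `GenEllDePersistentFamily`, `GenEllDePersistentPolys`: the persistent
set of `t_c = 1/r + c·r^{k+1}/(1−2x)` on `D_e : r^{2k+1} = x(1−x)` is phrased through the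
denominator-free collision relation `DeFamily.Collide`) and the configuration-protection file of the
abc-iut cell's GenEllTwo assembly (route item of `Summit.ABC.ABC.Theses.IUTThetaPilot`), whose
hypothesis `hCV` is phrased through `t_c`-VALUES
`t_c(z) = ((1−2x) + c·r^{k+2}) / (r·(1−2x))` lying in the set of critical values:

* `DeFamily.tval_eq` — the two ways of writing `t_c(z)` agree at non-polar points;
* `DeFamily.mem_persistentSet_of_tval_eq` — a non-special curve point whose `t_c`-value equals the
  `t_c`-value of a `t_c`-critical point lies (by its `x`-coordinate) in the persistent set;
* `DeFamily.exists_persistent_polys_tval` — the persistent family `(c_i, Pers_i)` of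
  `exists_persistent_polys` with the root clause restated in the `hCV` form: for every non-polar curve
  point `z` and every critical point `w` of `t_{c_i}` with `t_{c_i}(z) = t_{c_i}(w)`,
  `Pers_i(x(z)) = 0`, in any two algebraically closed fields of characteristic `0`.

Theorems only; classical; nothing here bears on the disputed parts of the abc-iut corpus.
-/

noncomputable section

open Polynomial

namespace Literature.NumberTheory.DiophantineGeometry.GenEll

namespace DeFamily

variable {Ω : Type*} [Field Ω]

/-- The two spellings of `t_c` agree at a non-polar point:
`((1−2x) + c·r^{k+2}) / (r·(1−2x)) = r⁻¹ + c·r^{k+1}/(1−2x)`. [cite: MochizukiGenEll2010, Thm 2.1 p.12] -/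
theorem tval_eq (k : ℕ) (c : Ω) {z : Ω × Ω} (hz : NonSpecial z) :
    ((1 - 2 * z.1) + c * z.2 ^ (k + 2)) / (z.2 * (1 - 2 * z.1)) =
      z.2⁻¹ + c * z.2 ^ (k + 1) / (1 - 2 * z.1) := by
  obtain ⟨hr, hs⟩ := hz
  field_simp
  ring

variable [CharZero Ω]

/-- A non-special curve point whose `t_c`-value (`c ≠ 0`) is the `t_c`-value of a `t_c`-CRITICAL
point lies, by its `x`-coordinate, in the persistent set of `c`. [cite: MochizukiGenEll2010, Thm 2.1 p.12] -/
theorem mem_persistentSet_of_tval_eq {k : ℕ} {c : Ω} (hc : c ≠ 0) {z w : Ω × Ω} (hz : OnCurve k z)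
    (hzns : NonSpecial z) (hw : OnCurve k w) (hN : N k c w = 0)
    (ht : ((1 - 2 * z.1) + c * z.2 ^ (k + 2)) / (z.2 * (1 - 2 * z.1)) =
      ((1 - 2 * w.1) + c * w.2 ^ (k + 2)) / (w.2 * (1 - 2 * w.1))) :
    z.1 ∈ persistentSet k c := by
  have hwns := nonSpecial_of_N_eq_zero hc hw hN
  rw [tval_eq k c hzns, tval_eq k c hwns] at ht
  exact ⟨z, rfl, hz, hzns, w, hw, hN, (collide_iff k c hzns hwns).mpr ht⟩

/-- **The persistent family in the `t_c`-value form.** For `k ≥ 3`, `n`, and two algebraically closed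
fields `Ω₁, Ω₂` of characteristic `0`: nonzero pairwise distinct rationals `c_i` and nonzero pairwise
coprime `Pers_i ∈ ℚ[X]` such that, at both places, `Pers_i` vanishes at `x(z)` for every non-polar
curve point `z` sharing its `t_{c_i}`-value with a `t_{c_i}`-critical point `w` — the hypothesis `hCV`
of the configuration-protection step with `CV :=` the critical values of `t_{c_i}`.
[cite: MochizukiGenEll2010, Thm 2.1 p.12] -/
theorem exists_persistent_polys_tval (Ω₁ Ω₂ : Type*) [Field Ω₁] [CharZero Ω₁] [IsAlgClosed Ω₁]
    [Field Ω₂] [CharZero Ω₂] [IsAlgClosed Ω₂] {k : ℕ} (hk : 3 ≤ k) (n : ℕ) :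
    ∃ (c : Fin n → ℚ) (Pers : Fin n → ℚ[X]), (∀ i, c i ≠ 0) ∧ Function.Injective c ∧
      (∀ i, Pers i ≠ 0) ∧ Pairwise (fun i j => IsCoprime (Pers i) (Pers j)) ∧
      (∀ i, ∀ z w : Ω₁ × Ω₁, OnCurve k z → z.2 ≠ 0 → 1 - 2 * z.1 ≠ 0 → OnCurve k w →
        N k (c i : Ω₁) w = 0 →
        ((1 - 2 * z.1) + (c i : Ω₁) * z.2 ^ (k + 2)) / (z.2 * (1 - 2 * z.1)) =
          ((1 - 2 * w.1) + (c i : Ω₁) * w.2 ^ (k + 2)) / (w.2 * (1 - 2 * w.1)) →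
        aeval z.1 (Pers i) = 0) ∧
      (∀ i, ∀ z w : Ω₂ × Ω₂, OnCurve k z → z.2 ≠ 0 → 1 - 2 * z.1 ≠ 0 → OnCurve k w →
        N k (c i : Ω₂) w = 0 →
        ((1 - 2 * z.1) + (c i : Ω₂) * z.2 ^ (k + 2)) / (z.2 * (1 - 2 * z.1)) =
          ((1 - 2 * w.1) + (c i : Ω₂) * w.2 ^ (k + 2)) / (w.2 * (1 - 2 * w.1)) →
        aeval z.1 (Pers i) = 0) := by
  obtain ⟨c, Pers, hc0, hinj, hP0, hcop, h₁, h₂⟩ := exists_persistent_polys Ω₁ Ω₂ hk n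
  refine ⟨c, Pers, hc0, hinj, hP0, hcop, fun i z w hz hr hs hw hN ht => h₁ i z.1 ?_,
    fun i z w hz hr hs hw hN ht => h₂ i z.1 ?_⟩
  · exact mem_persistentSet_of_tval_eq (Rat.cast_ne_zero.mpr (hc0 i)) hz ⟨hr, hs⟩ hw hN ht
  · exact mem_persistentSet_of_tval_eq (Rat.cast_ne_zero.mpr (hc0 i)) hz ⟨hr, hs⟩ hw hN ht

end DeFamily

end Literature.NumberTheory.DiophantineGeometry.GenEll
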